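import Summits.FinalStateConjecture.FinalStateConjecture.Theorems.ChannelsResolveTameDevelopmentsR.Negative.SubMinkowski
import Summits.FinalStateConjecture.FinalStateConjecture.Theorems.WeakCosmicCensorshipMGHD.Negative.LoadBearing
import Summits.FinalStateConjecture.FinalStateConjecture.Theorems.PhotonSphereChannelsEndVisibleDefs
import Literature.Geometry.Lorentzian.CauchyProblemProofs
import Literature.Geometry.Lorentzian.GeodesicProofs
import Literature.Geometry.Lorentzian.TrivialDataAdmissible
import HarnessLib

/-!
# NoHidden AT THE MODEL POINT: in Minkowski space `(ℝ⁴, η)` every event on or above the slice is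
# end-visible, so the registered stub `stub_noHiddenCompleteRays` of line `Sketch` (crux
# `ChannelsResolveTameDevelopmentsR`, K2R-T2, item `stmt-FinalStateConjecture-17430`, route
# PhotonSphereChannels) HOLDS when instantiated at the one certified vacuum Cauchy development of the
# one certified admissible datum — model certificate, companion of `Negative/SubMinkowskiEndVisible`

`Negative/SubMinkowskiEndVisible` proves NoHidden per development (`EndVisible.CompleteRaysNearEndVisible`)
on the open sub-developments `η|_U` of the trivial datum with `{x⁰ ≥ 0} ⊆ U`. The bundled Minkowski
development `Minkowski.vacuumCauchyDevelopment` (carrier `E4` itself, not `η|_⊤`) is the development at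
which the tree certifies ALL analytic hypotheses of the crux — complete `𝓘⁺`
(`WeakCosmicCensorshipMGHD.Negative.minkowski_hasCompleteNullInfinity`), (i) no extremal remnant
(`MinkowskiModel.minkowski_noExtremalRemnant`, Kretschmann exclusion,
`Theorems/PhotonSphereChannelsChannelsResolveTameDevelopmentsRMinkowskiNoExtremalRemnant`), (ii) tame
outer region (`MinkowskiModel.minkowski_tameOuter`, ibid.) — everything but `IsMaximal`, which holds
given the Choquet-Bruhat–Geroch theorem (`Minkowski.isMaximal_vacuumCauchyDevelopment`,
`CompleteDevelopmentMaximal.lean`) and up to which every maximal development of the trivial datum IS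
this one (`Minkowski.isIsometricTo_vacuumCauchyDevelopment_of_isMaximal`). This file adds NoHidden's
conclusion at that point:

* `ray_eq_line` — a normalised null ray of `(ℝ⁴, η)` from the slice point `y` is the WHOLE straight
  null line `t ↦ (0, y) + t v`, `v = γ'(0)`, `v⁰ = 1`, on `dom = ℝ` (straight lines are geodesics,
  `ModelSpace.isGeodesic_line`; uniqueness `IsGeodesicOn.eqOn_of_velocity_eq_holds`; maximality);
* `minkowski_isEndVisibleEvent_of_time_nonneg` — **every event `x` with `x⁰ ≥ 0` is end-visible**: for
  compact `K ⊆ ℝ³` launch from a slice point `y ∉ K` with `‖y‖ > x⁰ + ‖x̲‖` the null line aimed at `x̲`;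
  it is a future-complete normalised null ray through `(L, x̲)`, `L = ‖x̲ − y‖ > x⁰`, and the vertical
  segment from `x` to `(L, x̲)` is timelike: `x ≪ γ(L)`;
* `minkowski_completeRaysNearEndVisible` — **NoHidden per development holds for Minkowski space**
  (ray points with `t ≥ 0` have `x⁰ = t ≥ 0`);
* `noHidden_instantiated_at_minkowski` — admissibility of the datum, complete `𝓘⁺` and NoHidden hold
  TOGETHER at the model point ((i), (ii) hold there too: `MinkowskiModel.minkowski_noExtremalRemnant`,
  `MinkowskiModel.minkowski_tameOuter`, not re-imported here);
* `stub_noHiddenCompleteRays_at_minkowski` — the registered stub's body at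
  `(X, D, 𝒟) = (ℝ³, (δ, 0), Minkowski.vacuumCauchyDevelopment)` is a THEOREM (all five hypotheses idle):
  the stub is not refutable at the model point, and its hypothesis block is consistent with its
  conclusion.

All results proved; no named facts.

## References

* B. O'Neill, *Semi-Riemannian geometry* (1983), Ch. 3, Example 25 and Prop. 24 (geodesics of `ℝⁿ₁`),
  Ch. 5, p. 145 and Ch. 14, p. 402 (causal relations of `ℝ⁴₁`).
* S. W. Hawking, G. F. R. Ellis, *The large scale structure of space-time* (1973), §5.1, §9.2.
* D. Christodoulou, CQG 16 (1999) A23, pp. A26–A27.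
* M. Dafermos, J. Luk, arXiv:1710.01722, Conjecture 1.
-/

noncomputable section

open Bundle Set Function Filter TopologicalSpace Topology Metric
open scoped Manifold ContDiff Topology ENNReal

-- the problem namespace `Summit.FinalStateConjecture.FinalStateConjecture` repeats a segment by design (D-0022)
set_option linter.dupNamespace false

namespace Summit.FinalStateConjecture.FinalStateConjecture.Theorems.ChannelsResolveTameDevelopmentsR.MinkowskiModel

open Literature.Geometry.Lorentzian Literature.Geometry.Lorentzian.Minkowski
open Summit.FinalStateConjecture.FinalStateConjecture.Theorems.WeakCosmicCensorshipMGHD.Negative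
  (dirE3 norm_dirE3 minkowski_hasCompleteNullInfinity)
open Summit.FinalStateConjecture.FinalStateConjecture.Theorems.ChannelsResolveTameDevelopmentsR.SubMinkowski
  (isFutureTimelikeCurveOn_line)
open Summit.FinalStateConjecture.FinalStateConjecture.Theorems.EndVisible

/-! ### Normalised null rays of Minkowski space are whole straight lines -/

/-- **A normalised null ray of Minkowski space from the slice is the whole straight null line**: if
`γ` is a normalised future null ray of `(ℝ⁴, η, ∂ₜ)` from the slice point `y` on the affine domain
`dom`, then `dom = ℝ` and `γ(t) = (0, y) + t v` for all `t`, where `v = γ'(0)` has `v⁰ = 1`. The straight line with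
the same initial data is a geodesic on `ℝ` (`ModelSpace.isGeodesic_line`), agrees with `γ` on `dom`
(uniqueness, `IsGeodesicOn.eqOn_of_velocity_eq_holds`), so maximality of `γ` forces `dom = ℝ`; the
normalisation `η(γ'(0), ∂ₜ) = −1` is `γ'(0)⁰ = 1`. [cite: ONeill1983, Ch. 3, Example 3.25] -/
theorem ray_eq_line [hLC : vacuumCauchyDevelopment.metric.HasLeviCivita] {y : slice} {γ : ℝ → E4}
    {dom : Set ℝ}
    (hray : vacuumCauchyDevelopment.metric.IsNormalisedNullRayFrom vacuumCauchyDevelopment.timeOrientation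
      vacuumCauchyDevelopment.embed vacuumCauchyDevelopment.normal y γ dom) :
    dom = univ ∧ ∃ v : E4, velocity 𝓘(ℝ, E4) γ 0 = v ∧ v 0 = 1 ∧
      ∀ t, γ t = E4.ofTimeSpace 0 (y : E3) + t • v := by
  haveI hLC' : smoothMetric.toPseudoRiemannianMetric.HasLeviCivita := hLC
  haveI : CovariantDerivative.ContMDiffCovariantDerivative smoothMetric.toPseudoRiemannianMetric.leviCivita 1 :=
    ⟨smoothMetric.toPseudoRiemannianMetric.isLocallyContMDiff_leviCivita_holds 1
      (by rw [show ((1 : ℕ∞) : ℕ∞ω) + 1 = 2 by norm_num]; exact WithTop.coe_le_coe.2 le_top)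
      univ isOpen_univ⟩
  obtain ⟨hmax, h0, hγ0, -, -, hnorm⟩ := hray
  change IsMaximalGeodesicOn smoothMetric.toPseudoRiemannianMetric.leviCivita γ dom at hmax
  have hγ0' : γ 0 = E4.ofTimeSpace 0 (y : E3) := hγ0
  set v : E4 := velocity 𝓘(ℝ, E4) γ 0 with hv
  -- the straight line with the same initial data is a geodesic on `ℝ` agreeing with `γ` on `dom`
  set ℓ : ℝ → E4 := fun s ↦ E4.ofTimeSpace 0 (y : E3) + s • v with hℓ
  have hℓgeo : IsGeodesic smoothMetric.toPseudoRiemannianMetric.leviCivita ℓ :=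
    ModelSpace.isGeodesic_line (g := smoothMetric.toPseudoRiemannianMetric) (G₀ := bilin) smoothMetric_val _ _
  have heq : EqOn γ ℓ dom :=
    IsGeodesicOn.eqOn_of_velocity_eq_holds hmax.isOpen hmax.2.1 hmax.isGeodesicOn (hℓgeo.isGeodesicOn dom)
      h0 (by rw [hγ0', hℓ]; simp) (by rw [hℓ, ModelSpace.velocity_line])
  have huniv : univ = dom := hmax.2.2.2 ℓ univ isOpen_univ ordConnected_univ (subset_univ _) hℓgeo heq
  -- normalisation: `v⁰ = 1`
  have hv0 : v 0 = 1 := by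
    have h' : bilin (velocity 𝓘(ℝ, E4) γ 0) (E4.basisVector 0) = -1 := hnorm
    rw [bilin_symm, bilin_basisVector_zero_left] at h'
    linarith
  refine ⟨huniv.symm, v, rfl, hv0, fun t ↦ ?_⟩
  exact heq (huniv ▸ mem_univ t)

/-! ### Every event on or above the slice is end-visible -/

/-- **IN MINKOWSKI SPACE EVERY EVENT ON OR ABOVE THE SLICE IS END-VISIBLE.** Let `x⁰ ≥ 0` and let
`K ⊆ ℝ³` be compact, `K ⊆ B̄(0, R₁)`. Launch from the slice point `y = r e₃`,
`r = max (x⁰ + ‖x̲‖) |R₁| + 1 ∉ K`, the straight null line `γ(t) = (0, y) + t (1, e)`,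
`e = (x̲ − y)/L`, `L = ‖x̲ − y‖ > x⁰ ≥ 0`: a geodesic on `ℝ` (`ModelSpace.isGeodesic_line`), hence a
maximal one (`IsGeodesic.isMaximalGeodesicOn_univ`), null, future-directed and normalised
(`η((1, e), ∂ₜ) = −1`) — a future-complete normalised null ray from `y ∉ K`. It passes through
`γ(L) = (L, x̲) = x + (L − x⁰) ∂ₜ`, the endpoint of the vertical future timelike segment
`σ ↦ x + σ (L − x⁰) ∂ₜ`, `σ ∈ [0, 1]` (`isFutureTimelikeCurveOn_line`): `x ≪ γ(L)`, so
`x ∈ I⁻(γ(dom ∩ [0, ∞)))`. [cite: HawkingEllis1973, §9.2] -/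
theorem minkowski_isEndVisibleEvent_of_time_nonneg [hLC : vacuumCauchyDevelopment.metric.HasLeviCivita]
    {x : E4} (hx : 0 ≤ x 0) : IsEndVisibleEvent vacuumCauchyDevelopment.toCauchyDevelopment x := by
  intro K hK
  haveI hLC' : smoothMetric.toPseudoRiemannianMetric.HasLeviCivita := hLC
  -- `K` is bounded
  obtain ⟨R₁, hR₁⟩ := (Metric.isBounded_iff_subset_closedBall (0 : E3)).1
    (hK.image continuous_subtype_val).isBounded
  -- a far slice point `y ∉ K` with `‖y‖ > x⁰ + ‖x̲‖`
  set R₀ : ℝ := x 0 + ‖E4.spatial x‖ with hR₀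
  set r : ℝ := max R₀ |R₁| + 1 with hr
  have hr0 : 0 ≤ r := by
    have : 0 ≤ max R₀ |R₁| := (abs_nonneg R₁).trans (le_max_right _ _)
    linarith
  set y : slice := ⟨r • dirE3, mem_slice _⟩ with hy
  have hyn : ‖(y : E3)‖ = r := by
    show ‖r • dirE3‖ = r
    rw [norm_smul, norm_dirE3, mul_one, Real.norm_eq_abs, abs_of_nonneg hr0]
  have hyK : y ∉ K := fun hyK ↦ by
    have h1 := hR₁ ⟨y, hyK, rfl⟩
    rw [Metric.mem_closedBall, dist_zero_right, hyn] at h1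
    have : |R₁| < r := by
      have := le_max_right R₀ |R₁|; linarith
    linarith [le_abs_self R₁]
  have hyR : R₀ < ‖(y : E3)‖ := by rw [hyn]; have := le_max_left R₀ |R₁|; linarith
  -- the aiming direction `e = (x̲ - y)/L`, `L = ‖x̲ - y‖ > x⁰ ≥ 0`
  set d : E3 := E4.spatial x - (y : E3) with hd
  set L : ℝ := ‖d‖ with hL
  have hLge : ‖(y : E3)‖ - ‖E4.spatial x‖ ≤ L := by
    rw [hL, hd, norm_sub_rev]
    exact norm_sub_norm_le _ _
  have hLx : x 0 < L := by rw [hR₀] at hyR; linarith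
  have hLpos : 0 < L := lt_of_le_of_lt hx hLx
  set e : E3 := L⁻¹ • d with he
  have hen : ‖e‖ = 1 := by
    rw [he, norm_smul, norm_inv, Real.norm_eq_abs, abs_of_pos hLpos, ← hL, inv_mul_cancel₀ hLpos.ne']
  have hLe : L • e = d := by rw [he, smul_smul, mul_inv_cancel₀ hLpos.ne', one_smul]
  set v : E4 := E4.ofTimeSpace 1 e with hv
  have hv0 : v 0 = 1 := E4.ofTimeSpace_apply_zero 1 e
  have hvs : E4.spatial v = e := E4.spatial_ofTimeSpace 1 e
  have hvnull : bilin v v = 0 := by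
    rw [C0Extension.bilin_self_eq, hvs, hen, hv0]; norm_num
  have hvne : v ≠ 0 := fun h0 ↦ by
    have := congrArg (fun u : E4 ↦ u 0) h0
    rw [hv0] at this
    simp at this
  have hve₀ : bilin (E4.basisVector 0) v = -1 := by rw [bilin_basisVector_zero_left, hv0]
  -- the straight null line from `(0, y)` with velocity `v`: a maximal geodesic on `ℝ`
  set γ : ℝ → E4 := fun s ↦ E4.ofTimeSpace 0 (y : E3) + s • v with hγ
  have hγgeo : IsGeodesic smoothMetric.toPseudoRiemannianMetric.leviCivita γ :=
    ModelSpace.isGeodesic_line (g := smoothMetric.toPseudoRiemannianMetric) (G₀ := bilin) smoothMetric_val _ _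
  have hγmax : IsMaximalGeodesicOn smoothMetric.toPseudoRiemannianMetric.leviCivita γ univ :=
    IsGeodesic.isMaximalGeodesicOn_univ _ hγgeo
  have hvel : velocity 𝓘(ℝ, E4) γ 0 = v := by rw [hγ, ModelSpace.velocity_line]
  have hγ0 : γ 0 = E4.ofTimeSpace 0 (y : E3) := by simp [hγ]
  -- it is a normalised future null ray of the Minkowski development from `y`
  have hray : vacuumCauchyDevelopment.metric.IsNormalisedNullRayFrom vacuumCauchyDevelopment.timeOrientation
      vacuumCauchyDevelopment.embed vacuumCauchyDevelopment.normal y γ univ := by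
    refine ⟨hγmax, mem_univ _, hγ0, ?_, ?_, ?_⟩
    · change bilin (velocity 𝓘(ℝ, E4) γ 0) (velocity 𝓘(ℝ, E4) γ 0) = 0 ∧ velocity 𝓘(ℝ, E4) γ 0 ≠ 0
      rw [hvel]; exact ⟨hvnull, hvne⟩
    · change (bilin (velocity 𝓘(ℝ, E4) γ 0) (velocity 𝓘(ℝ, E4) γ 0) ≤ 0 ∧ velocity 𝓘(ℝ, E4) γ 0 ≠ 0) ∧
        bilin (E4.basisVector 0) (velocity 𝓘(ℝ, E4) γ 0) < 0
      rw [hvel, hve₀]; exact ⟨⟨hvnull.le, hvne⟩, by norm_num⟩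
    · change bilin (velocity 𝓘(ℝ, E4) γ 0) (E4.basisVector 0) = -1
      rw [hvel, bilin_symm, hve₀]
  -- the ray point `γ L = (L, x̲) = x + (L - x⁰) ∂ₜ`
  set s : ℝ := L - x 0 with hs_def
  have hs : 0 < s := by rw [hs_def]; linarith
  set w : E4 := s • E4.basisVector 0 with hw
  have hzval : γ L = x + w := by
    rw [hγ, hw, hv]
    ext i
    refine Fin.cases ?_ (fun j ↦ ?_) i
    · simp [hs_def]
    · have hj : (E4.ofTimeSpace 0 (y : E3) + L • E4.ofTimeSpace 1 e) j.succ = (y : E3) j + L * e j := by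
        simp
      have hj' : (x + s • E4.basisVector 0) j.succ = x j.succ := by
        simp [Fin.succ_ne_zero]
      rw [hj, hj']
      have hcomp := congrArg (fun u : E3 ↦ u j) hLe
      simp only [hd, PiLp.smul_apply, smul_eq_mul, PiLp.sub_apply, E4.spatial_apply] at hcomp
      linarith
  -- the vertical timelike segment from `x` to `γ L`
  have hw0 : w 0 = s := by simp [hw]
  have hws : ‖E4.spatial w‖ < w 0 := by
    rw [hw, map_smul, C0Extension.spatial_basisVector_zero, smul_zero, norm_zero, ← hw, hw0]
    exact hs
  have hℓM : spacetime.metric.IsFutureTimelikeCurveOn spacetime.timeOrientation (fun σ : ℝ ↦ x + σ • w)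
      (Icc 0 1) :=
    isFutureTimelikeCurveOn_line hws _
  have h1 : γ L ∈ spacetime.metric.chronologicalFuture spacetime.timeOrientation {x} :=
    ⟨x, rfl, fun σ : ℝ ↦ x + σ • w, 0, 1, zero_lt_one, hℓM, by simp, by rw [hzval]; simp⟩
  have hzimg : γ L ∈ γ '' (univ ∩ Ici 0) := ⟨L, ⟨mem_univ _, hLpos.le⟩, rfl⟩
  have hpast : x ∈ spacetime.metric.chronologicalPast spacetime.timeOrientation (γ '' (univ ∩ Ici 0)) :=
    LorentzianMetric.chronologicalFuture_mono (g := spacetime.metric) (τ := spacetime.timeOrientation.reverse)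
      (singleton_subset_iff.mpr hzimg) (LorentzianMetric.mem_chronologicalPast_of_mem_chronologicalFuture h1)
  exact ⟨y, hyK, γ, univ, hray, not_bddAbove_univ, hpast⟩

/-- **NoHIDDEN PER DEVELOPMENT HOLDS FOR MINKOWSKI SPACE**: every point `γ t`, `t ≥ 0`, of every
future-complete normalised null ray of `(ℝ⁴, η)` from the slice lies in `closure (endVisibleRegion)` —
indeed is end-visible: `γ t = (0, y) + t v` with `v⁰ = 1` (`ray_eq_line`), so `(γ t)⁰ = t ≥ 0`
(`minkowski_isEndVisibleEvent_of_time_nonneg`). [cite: DafermosLuk2017, Conjecture 1] -/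
theorem minkowski_completeRaysNearEndVisible :
    CompleteRaysNearEndVisible vacuumCauchyDevelopment.toCauchyDevelopment := by
  intro hLC y γ dom hray _hunb t _ht ht0
  change ℝ → E4 at γ
  obtain ⟨-, v, -, hv0, hline⟩ := ray_eq_line hray
  refine subset_closure (minkowski_isEndVisibleEvent_of_time_nonneg ?_)
  rw [hline t]
  have : (E4.ofTimeSpace 0 (y : E3) + t • v) 0 = t * v 0 := by
    simp
  rw [this, hv0, mul_one]
  exact ht0

/-! ### The stub at the model point -/

/-- **ADMISSIBLE DATUM, COMPLETE `𝓘⁺` AND NoHIDDEN HOLD TOGETHER AT THE MODEL POINT.** The trivial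
datum is admissible (`trivialData_mem_admissibleVacuumData`), and at its certified vacuum Cauchy
development `Minkowski.vacuumCauchyDevelopment` future null infinity is complete
(`minkowski_hasCompleteNullInfinity`) AND NoHidden per development holds
(`minkowski_completeRaysNearEndVisible`). Hypotheses (i), (ii) of the stub hold there as well
(`MinkowskiModel.minkowski_noExtremalRemnant`, `MinkowskiModel.minkowski_tameOuter`, stated over the
`TameHull` copies of the route text), and `IsMaximal` holds given the Choquet-Bruhat–Geroch theorem
(`Minkowski.isMaximal_vacuumCauchyDevelopment`): the hypothesis block of `stub_noHiddenCompleteRays` is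
consistent with its conclusion and met, not dodged, at the dispersal end.
[cite: ChristodoulouKlainerman1993, Thm. 1.0.2] -/
theorem noHidden_instantiated_at_minkowski :
    trivialData ∈ admissibleVacuumData slice ∧
      _root_.Summit.FinalStateConjecture.HasCompleteNullInfinity vacuumCauchyDevelopment.toCauchyDevelopment ∧
        CompleteRaysNearEndVisible vacuumCauchyDevelopment.toCauchyDevelopment :=
  ⟨trivialData_mem_admissibleVacuumData, minkowski_hasCompleteNullInfinity, minkowski_completeRaysNearEndVisible⟩

/-- **THE REGISTERED STUB HOLDS AT THE MODEL POINT.** The body of `stub_noHiddenCompleteRays` (line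
`Sketch` of crux `ChannelsResolveTameDevelopmentsR`) instantiated at `X = ℝ³` (the Minkowski slice),
`D = (δ, 0)` (`trivialData`) and `𝒟 = Minkowski.vacuumCauchyDevelopment` is a theorem — with all five
hypotheses idle (`minkowski_completeRaysNearEndVisible`). Since every maximal vacuum Cauchy development of
the trivial datum is isometric, as a development, to this one
(`Minkowski.isIsometricTo_vacuumCauchyDevelopment_of_isMaximal`, unconditionally), a refutation of the
stub needs a datum other than the trivial one — on paper a second end or non-trivial topology of `Σ`
(the hidden-bag mechanism). [cite: DafermosLuk2017, Conjecture 1] -/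
theorem stub_noHiddenCompleteRays_at_minkowski :
    trivialData ∈ admissibleVacuumData slice → vacuumCauchyDevelopment.IsMaximal →
      _root_.Summit.FinalStateConjecture.HasCompleteNullInfinity vacuumCauchyDevelopment.toCauchyDevelopment →
        (TrappedSet.NoExtremalRemnant vacuumCauchyDevelopment ∧
            TrappedSet.TameOuterRegion vacuumCauchyDevelopment) →
          CompleteRaysNearEndVisible vacuumCauchyDevelopment.toCauchyDevelopment :=
  fun _ _ _ _ ↦ minkowski_completeRaysNearEndVisible

end Summit.FinalStateConjecture.FinalStateConjecture.Theorems.ChannelsResolveTameDevelopmentsR.MinkowskiModel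

end
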